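/-
Copyright (c) 2026 the pub-hodgecm-mathlib formalisation cell (harness21).  Prover seat hodgecm-mathlib-K2E3-p01 (g0), Track B ∕ K2-LIT
(build stream 29), h413 = `stmt-HodgeConjecture-24833`, line `K2_E3_EllipticInputs`, unit U3 «cubic Cartan + germs», DEAL «RAY» of
K2E3-plan (g1) DEALS BATCH #1 (K2/STATUS.md 2026-09-03T22:03:00Z).  2026-09-03.
-/
import Literature.NumberTheory.Rogawski1990.TypeThreeCubicTorusNonsplit      -- ★ one-place model at a non-split place: `localNonsplitEquiv` transport, `isRegularElt_iff_separable_localNonsplitEquiv`, `exists_antifixed`, `exists_fixed_not_cube`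
import Literature.NumberTheory.Weil1982.CayleyCentralShift                    -- ★ `exists_central_shift` (+ ★ `cayley`, `cayleyGL`, `cayley_comm_of_comm`, `transpose_map_cayley_mul_mul_cayley`)
import Literature.LinearAlgebra.Matrix.CayleyCharpolyDiscr                    -- ★ `discr_charpoly_cayley_mul_det_pow_four`, `charpoly_coeff_fin_three`
import Literature.LinearAlgebra.Matrix.CharpolyDiscTwinBridge                 -- ★ `isUnit_discr_iff_separable_of_monic`
import Summits.HodgeConjecture.HodgeConjecture.Theorems.F0P3cStCharTSHCDGroupToLie   -- ★ `discr_charpoly_smul_fin_three` (`disc(χ_{t•X}) = t⁶·disc(χ_X)`, road «HC-D»)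
import HarnessLib

/-!
# h413 ∕ Track B «K2-LIT», line `K2_E3_EllipticInputs`, unit U3: A RAY OF REGULAR ELEMENTS TENDING TO `1` IN THE CARTAN SUBGROUP `Z(γ₀)` OF `U(Φ₃)(L⁺_v)`,
# ALONG THE CAYLEY TRANSFORM OF A REGULAR ELEMENT OF ITS LIE ALGEBRA, WITH THE WEYL DISCRIMINANT DECAYING AT AN EXACT GEOMETRIC RATE

Cell `pub/hodgecm-mathlib`, crux H413 = `stmt-HodgeConjecture-24833`, route of record `HCCMUnconditional`; chair K2-lead (g0), dealer K2E3-plan (g1),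
DEALS BATCH #1 «p01 … NEXT `Theorems/K2E3CompactCartanRegularRay.lean` (p03 REPORT-1 clauses 2–3 «RAY»: `T = Z(γ₀)` compact, `γ₀` regular, EVERY non-split
`v`: regular `γ_n → 1` in `T` along a one-parameter ray with `‖D_G(γ_n)‖ → 0` controlled; feeds #3H)».  THEOREMS ONLY (no `def`, no `instance`, no
`notation`, no named-fact hypothesis, no `sorry`); imports = ★ Literature + HarnessLib; lane `--supports stmt-HodgeConjecture-24833 --as helper`
(count-neutral: it supplies the binders `γseq ∕ hγT ∕ hγ1` of ★ `K2E3GermResidueAtCubicTorusOfHomogeneity.germResidueAtTorus_of_homogeneityRay_nonsplit`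
(p855036) for EVERY `T = Z(γ₀)`, and the Cayley bookkeeping the homogeneity letter #3H of row #3 `sig_K2E3GermResidueAtCubicTorus` is to be read along).

THE MATHEMATICS ([Rogawski1990] §3.1 p. 19 (regular elements, Cartan subgroups `Z(γ₀)`), §8.1 (8.1.1) p. 116 (germs along `δ_t → 1`);
[PlatonovRapinchuk1994] §3.3 (the Cayley parametrisation `c(X) = (1 + X)(1 − X)⁻¹` of a unitary group by its Lie algebra); [HarishChandra1970] §VII
(`D_G`)).  Compactness of `T` is NOT used, and nothing is specific to type (3): the ray exists in EVERY Cartan subgroup `Z(γ₀)`, `γ₀` regular.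
* §1 (any commutative ring; `3 × 3`).  `disc(χ_{t•X}) = t⁶·disc(χ_X)` (★ `discr_charpoly_smul_fin_three`); hence for a unit `t` and through the Cayley transform
  (★ `disc(χ_{c(X)})·det(1 − X)⁴ = 2⁶·disc(χ_X)`, `2` a unit) SEPARABILITY OF THE CHARACTERISTIC POLYNOMIAL IS PRESERVED (`separable_charpoly_smul_iff`,
  `separable_charpoly_cayley_iff`; separable ⟺ `disc` a unit, ★ `isUnit_discr_iff_separable_of_monic`).
* §2 (field `K`, `σ`, `J` invertible, `2 ≠ 0`, the norm-one set `{z | σz·z = 1}` infinite).  **The Lie algebra of the Cartan subgroup `Z(g)` of a REGULAR unitary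
  `g` has a REGULAR element**: ★ `exists_central_shift` writes `g = z·c(X₀)` with `X₀` skew (`ᵗ(σX₀)J + JX₀ = 0`) commuting with `g`; by §1, `χ_{X₀}` is
  separable because `χ_g` is (`exists_regular_skew_comm`).
* §3 (normed field `K`; `σ t = t`, `0 < ‖t‖ < 1`).  THE CAYLEY RAY `u_n = c(t^{n+n₀}•X₀)`: `t^m•X₀ → 0`, so `det(1 ± t^m X₀) → 1` are units from some `n₀` on;
  `u_n ∈ U(σ, J)` (★ `transpose_map_cayley_mul_mul_cayley`), `u_n` commutes with `g` (★ `cayley_comm_of_comm`), `χ_{u_n}` is separable with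
  **`disc(χ_{u_n})·det(1 − t^{n+n₀}X₀)⁴ = 2⁶·t^{6(n+n₀)}·disc(χ_{X₀})`** (exact geometric decay of the discriminant, i.e. of `|D_G(u_n)| = |disc χ_{u_n}|∕|det u_n|²`,
  `det u_n` a unit of modulus one), and **`u_n → 1` in the `GL`-topology** (`u_n⁻¹ = c(−t^{n+n₀}X₀)` explicitly; `A⁻¹ = det(A)⁻¹ • adj A` and continuity of
  `det`, `adj`, `(·)⁻¹`; Mathlib `Units.isEmbedding_embedProduct`) — `exists_cayleyRay`.
* §4 (CM export at a NON-SPLIT place `v` of `L⁺`, `w ∣ v`).  The norm-one set of `L_w` is infinite (`a ↦ (a + δ)∕(a − δ)`, `a ∈ ℕ`, `σ_w δ = −δ`, ★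
  `exists_antifixed`); `t = ϖ·σ_wϖ` (★ `exists_fixed_not_cube`: `σ_w t = t ≠ 0`, `v_w(t) < 1`); transport along the one-place model ★ `localNonsplitEquiv`
  (a homeomorphic group isomorphism; regularity read at `w`, ★ `isRegularElt_iff_separable_localNonsplitEquiv`):
  **`compactCartanRegularRay_controlled`** (the ray in `Z(γ₀) ≤ Gqs L v` with its Cayley presentation and discriminant identity at `w`) and
  **`compactCartanRegularRay`** (the consumer form: `∀ T γ₀, IsRegularElt γ₀ → T = Z(γ₀) → ∃ γseq, (∀ n, γseq n ∈ T ∧ regular) ∧ γseq → 1`).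

WHAT IS NOT HERE.  Homogeneity of the Shalika germs along the ray (#3H, [Rogawski1990] Prop. 8.1.2 (b)); the split places (same Cayley ray in `GL₃(L⁺_v)`, not needed by row #3).
HONEST LABEL.  HC_CM is proved only modulo the 7 printed citations (2 remaining named inputs: hLiu418 = `stmt-HodgeConjecture-24832`, h413 =
`stmt-HodgeConjecture-24833`) until rung 0 closes; this file is a count-neutral helper of the U3 unit (it pays no socket by itself).

## References
* [Rogawski1990] J. D. Rogawski, *Automorphic Representations of Unitary Groups in Three Variables*, Ann. of Math. Stud. 123 (1990), §3.1 p. 19, §3.6 p. 31,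
  §8.1 (8.1.1)–(8.1.2) p. 116, §12.7 p. 194.
* [PlatonovRapinchuk1994] V. Platonov, A. Rapinchuk, *Algebraic Groups and Number Theory* (1994), §3.3 (Cayley parametrisation; congruence subgroups).
* [HarishChandra1970] Harish-Chandra, *Harmonic analysis on reductive p-adic groups*, LNM 162 (1970), Part VII §1 (the Weyl discriminant `D_G`).
* [BasuPollackRoy2006] S. Basu, R. Pollack, M.-F. Roy, *Algorithms in Real Algebraic Geometry*, 2nd ed. (2006), §4.1 Notation 4.1, Prop. 4.3 (discriminant, separability).
-/

set_option autoImplicit false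
-- the mandated namespace repeats the single-problem summit's segment (`HodgeConjecture.HodgeConjecture`), as in every `Theorems/*.lean` of this sub-problem
set_option linter.dupNamespace false

noncomputable section

open NumberField IsDedekindDomain Filter Topology Polynomial
open scoped Matrix MatrixGroups
open Literature.NumberTheory.Rogawski1990 Literature.NumberTheory.Automorphic Literature.NumberTheory.Automorphic.UnitaryGroup
open Literature.NumberTheory.Weil1982.UnitaryFinTopForm Literature.LinearAlgebra.Matrix
open Literature.NumberTheory.Rogawski1990.TypeThreeTorus
open Summit.HodgeConjecture.HodgeConjecture.Cruxes.H413.F0P3cStCharTSHCDGroupToLie (discr_charpoly_smul_fin_three)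

namespace Summit.HodgeConjecture.HodgeConjecture.Cruxes.H413.K2E3CompactCartanRegularRay

/-! ## §1 Separability of the characteristic polynomial under scaling and under the Cayley transform (`3 × 3`, any commutative ring) -/

section Algebra

variable {R : Type*} [CommRing R]

/-- **Scaling by a unit preserves separability of `χ`**: `χ_{t•X}` separable ⟺ `χ_X` separable (`t` a unit; separable ⟺ `disc` a unit for a monic polynomial,
★ `isUnit_discr_iff_separable_of_monic`). [cite: BasuPollackRoy2006, §4.1 Prop. 4.3] -/
theorem separable_charpoly_smul_iff {t : R} (ht : IsUnit t) (M : Matrix (Fin 3) (Fin 3) R) :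
    (t • M).charpoly.Separable ↔ M.charpoly.Separable := by
  rw [← isUnit_discr_iff_separable_of_monic (Matrix.charpoly_monic _), ← isUnit_discr_iff_separable_of_monic (Matrix.charpoly_monic _),
    discr_charpoly_smul_fin_three, IsUnit.mul_iff, and_iff_right (ht.pow 6)]

/-- **The Cayley transform preserves separability of `χ`** (`2` and `det(1 − X)` units): `χ_{c(X)}` separable ⟺ `χ_X` separable, `c(X) = (1 + X)(1 − X)⁻¹` — from
★ `disc(χ_{c(X)})·det(1 − X)⁴ = 2⁶·disc(χ_X)` (the roots of `χ_{c(X)}` are the Möbius images of those of `χ_X`). [cite: PlatonovRapinchuk1994, §3.3]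
[cite: BasuPollackRoy2006, §4.1 Prop. 4.3] -/
theorem separable_charpoly_cayley_iff (h2 : IsUnit (2 : R)) {A : Matrix (Fin 3) (Fin 3) R} (hA : IsUnit (1 - A).det) :
    (cayley A).charpoly.Separable ↔ A.charpoly.Separable := by
  rw [← isUnit_discr_iff_separable_of_monic (Matrix.charpoly_monic _), ← isUnit_discr_iff_separable_of_monic (Matrix.charpoly_monic _), cayley_def]
  have key := discr_charpoly_cayley_mul_det_pow_four A hA
  constructor
  · intro h
    have h' : IsUnit (2 ^ 6 * A.charpoly.discr) := by rw [← key]; exact h.mul (hA.pow 4)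
    exact (IsUnit.mul_iff.mp h').2
  · intro h
    have h' : IsUnit (((1 + A) * (1 - A)⁻¹).charpoly.discr * (1 - A).det ^ 4) := by rw [key]; exact (h2.pow 6).mul h
    exact (IsUnit.mul_iff.mp h').1

/-- **The discriminant along a scaled Cayley transform**: `disc(χ_{c(t•X)})·det(1 − t•X)⁴ = 2⁶·t⁶·disc(χ_X)`. [cite: PlatonovRapinchuk1994, §3.3]
[cite: BasuPollackRoy2006, §4.1 Notation 4.1] -/
theorem discr_charpoly_cayley_smul (t : R) {X₀ : Matrix (Fin 3) (Fin 3) R} (h : IsUnit (1 - t • X₀).det) :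
    (cayley (t • X₀)).charpoly.discr * (1 - t • X₀).det ^ 4 = 2 ^ 6 * t ^ 6 * X₀.charpoly.discr := by
  rw [cayley_def, discr_charpoly_cayley_mul_det_pow_four _ h, discr_charpoly_smul_fin_three, mul_assoc]

/-- Scaling a skew matrix by a `σ`-fixed scalar keeps it skew: `ᵗσ(t•X)·J + J·(t•X) = t•(ᵗσX·J + J·X) = 0`. [cite: PlatonovRapinchuk1994, §3.3] -/
theorem skew_smul_of_fixed (σ : R →+* R) {J X₀ : Matrix (Fin 3) (Fin 3) R} (hX₀ : (X₀.map σ)ᵀ * J + J * X₀ = 0) {t : R} (ht : σ t = t) :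
    ((t • X₀).map σ)ᵀ * J + J * (t • X₀) = 0 := by
  have hmap : (t • X₀).map σ = t • X₀.map σ := by
    ext i j
    simp only [Matrix.map_apply, Matrix.smul_apply, smul_eq_mul, map_mul, ht]
  rw [hmap, Matrix.transpose_smul, Matrix.smul_mul, Matrix.mul_smul, ← smul_add, hX₀, smul_zero]

end Algebra

/-! ## §2 The Lie algebra of the Cartan subgroup of a regular unitary element has a regular element (field) -/

section Field

variable {K : Type*} [Field K]

/-- **A REGULAR ELEMENT OF THE LIE ALGEBRA OF `Z(g)`.**  Let `σ : K →+* K`, `J` invertible, `2 ≠ 0`, and assume the norm-one set `{z | σ z·z = 1}` is infinite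
(e.g. `K ⊃ K^σ` a quadratic extension of local fields).  If `g` is unitary (`ᵗ(σg)·J·g = J`) with SEPARABLE characteristic polynomial (regular semisimple),
there is `X₀ ∈ M₃(K)` which is SKEW (`ᵗ(σX₀)·J + J·X₀ = 0`: the Lie algebra of `U(σ, J)`), COMMUTES with `g` (the Lie algebra of the Cartan subgroup `Z(g)`),
and has SEPARABLE characteristic polynomial.  Proof: ★ `exists_central_shift` gives `g = z·c(X₀)` with `z ≠ 0`, `X₀` skew commuting with `g`, `det(1 − X₀)` a
unit; `χ_g = χ_{z·c(X₀)}` separable ⟹ `χ_{c(X₀)}` separable (§1, `z` a unit) ⟹ `χ_{X₀}` separable (§1, through the Cayley transform).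
[cite: PlatonovRapinchuk1994, §3.3] [cite: Rogawski1990, §3.1 p. 19] -/
theorem exists_regular_skew_comm (σ : K →+* K) (h2 : (2 : K) ≠ 0) {J g : Matrix (Fin 3) (Fin 3) K} (hJ : IsUnit J.det)
    (hU : (g.map σ)ᵀ * J * g = J) (hreg : g.charpoly.Separable) (hE : {z : K | σ z * z = 1}.Infinite) :
    ∃ X₀ : Matrix (Fin 3) (Fin 3) K, (X₀.map σ)ᵀ * J + J * X₀ = 0 ∧ X₀ * g = g * X₀ ∧ X₀.charpoly.Separable := by
  obtain ⟨z, X₀, -, hz0, hskew, hcomm, hm, -, hg⟩ := exists_central_shift σ h2 hJ hU (x := g) rfl hE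
  refine ⟨X₀, hskew, hcomm, ?_⟩
  have h2u : IsUnit (2 : K) := isUnit_iff_ne_zero.2 h2
  rw [← separable_charpoly_cayley_iff h2u hm, ← separable_charpoly_smul_iff (isUnit_iff_ne_zero.2 hz0), ← hg]
  exact hreg

end Field

/-! ## §3 The Cayley ray in `U(σ, J)(K)` over a normed field -/

section Normed

variable {K : Type*} [NormedField K]

/-- `tⁿ • X → 0` for `‖t‖ < 1`. [folklore] -/
theorem tendsto_pow_smul {t : K} (ht : ‖t‖ < 1) (X₀ : Matrix (Fin 3) (Fin 3) K) :
    Tendsto (fun n : ℕ => t ^ n • X₀) atTop (𝓝 0) := by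
  simpa using (tendsto_pow_atTop_nhds_zero_of_norm_lt_one ht).smul (tendsto_const_nhds (x := X₀))

/-- **Matrix inversion is continuous at `1` along a filter**: `A_i → 1 ⟹ A_i⁻¹ → 1` (`A⁻¹ = det(A)⁻¹ • adj A`, Mathlib `Matrix.inv_def`; `det`, `adj` are polynomial,
`(·)⁻¹` is continuous at `1 ≠ 0`). [folklore] -/
theorem tendsto_inv_of_tendsto_one {ι : Type*} {l : Filter ι} {n : Type*} [Fintype n] [DecidableEq n] {A : ι → Matrix n n K}
    (hA : Tendsto A l (𝓝 1)) : Tendsto (fun i => (A i)⁻¹) l (𝓝 1) := by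
  have hdet : Tendsto (fun i => (A i).det) l (𝓝 1) := by
    have h := ((continuous_id.matrix_det).tendsto (1 : Matrix n n K)).comp hA
    simpa [Function.comp_def] using h
  have hadj : Tendsto (fun i => (A i).adjugate) l (𝓝 1) := by
    have h := ((continuous_id.matrix_adjugate).tendsto (1 : Matrix n n K)).comp hA
    simpa [Function.comp_def] using h
  have hinv : Tendsto (fun i => ((A i).det)⁻¹) l (𝓝 1) := by simpa using hdet.inv₀ one_ne_zero
  have h : Tendsto (fun i => ((A i).det)⁻¹ • (A i).adjugate) l (𝓝 ((1 : K) • (1 : Matrix n n K))) := hinv.smul hadj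
  rw [one_smul] at h
  refine h.congr' (Eventually.of_forall fun i => ?_)
  show _ = (A i)⁻¹
  rw [Matrix.inv_def, Ring.inverse_eq_inv]

/-- **THE CAYLEY RAY OF REGULAR UNITARY ELEMENTS TENDING TO `1`.**  `K` a normed field, `σ : K →+* K`, `J ∈ M₃(K)` invertible, `2 ≠ 0`, the norm-one set infinite;
`g` unitary with separable characteristic polynomial; `t ∈ K` with `σ t = t`, `t ≠ 0`, `‖t‖ < 1`.  Then there are a skew `X₀` commuting with `g` with `χ_{X₀}` separable
(§2), an index `n₀` and a sequence `u : ℕ → U(σ, J)(K)` with, for every `n`: `det(1 ∓ t^{n+n₀}X₀)` units, `u_n = c(t^{n+n₀}•X₀)` and `u_n⁻¹ = c(−t^{n+n₀}•X₀)` as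
matrices, `u_n` commutes with `g` (so `u_n ∈ Z(g)`), `χ_{u_n}` separable (`u_n` regular), the exact discriminant identity
`disc(χ_{u_n})·det(1 − t^{n+n₀}X₀)⁴ = 2⁶·t^{6(n+n₀)}·disc(χ_{X₀})` with `det(1 − t^{n+n₀}X₀) → 1`; and `u_n → 1` in `U(σ, J)(K)` (topology of `GL₃(K)`).
[cite: PlatonovRapinchuk1994, §3.3] [cite: Rogawski1990, §3.1 p. 19; §8.1 (8.1.1) p. 116] -/
theorem exists_cayleyRay (σ : K →+* K) (h2 : (2 : K) ≠ 0) {J g : Matrix (Fin 3) (Fin 3) K} (hJ : IsUnit J.det)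
    (hU : (g.map σ)ᵀ * J * g = J) (hreg : g.charpoly.Separable) (hE : {z : K | σ z * z = 1}.Infinite)
    {t : K} (hσt : σ t = t) (ht0 : t ≠ 0) (ht1 : ‖t‖ < 1) :
    ∃ (X₀ : Matrix (Fin 3) (Fin 3) K) (n₀ : ℕ) (u : ℕ → ↥(unitaryGroupOfForm σ J)),
      (X₀.map σ)ᵀ * J + J * X₀ = 0 ∧ X₀ * g = g * X₀ ∧ X₀.charpoly.Separable ∧
      (∀ n, IsUnit (1 - t ^ (n + n₀) • X₀).det ∧ IsUnit (1 + t ^ (n + n₀) • X₀).det ∧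
        ((u n : GL (Fin 3) K) : Matrix (Fin 3) (Fin 3) K) = cayley (t ^ (n + n₀) • X₀) ∧
        (((u n : GL (Fin 3) K)⁻¹ : GL (Fin 3) K) : Matrix (Fin 3) (Fin 3) K) = cayley (-(t ^ (n + n₀) • X₀))) ∧
      (∀ n, ((u n : GL (Fin 3) K) : Matrix (Fin 3) (Fin 3) K) * g = g * ((u n : GL (Fin 3) K) : Matrix (Fin 3) (Fin 3) K)) ∧
      (∀ n, (((u n : GL (Fin 3) K) : Matrix (Fin 3) (Fin 3) K)).charpoly.Separable) ∧
      (∀ n, (((u n : GL (Fin 3) K) : Matrix (Fin 3) (Fin 3) K)).charpoly.discr * (1 - t ^ (n + n₀) • X₀).det ^ 4 =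
        2 ^ 6 * t ^ (6 * (n + n₀)) * X₀.charpoly.discr) ∧
      Tendsto (fun n => (1 - t ^ (n + n₀) • X₀).det) atTop (𝓝 1) ∧
      Tendsto u atTop (𝓝 1) := by
  obtain ⟨X₀, hskew, hcomm, hXsep⟩ := exists_regular_skew_comm σ h2 hJ hU hreg hE
  have h2u : IsUnit (2 : K) := isUnit_iff_ne_zero.2 h2
  -- the Lie-algebra ray `Y m = t^m • X₀ → 0`
  set Y : ℕ → Matrix (Fin 3) (Fin 3) K := fun m => t ^ m • X₀ with hY_def
  have hY : Tendsto Y atTop (𝓝 0) := tendsto_pow_smul ht1 X₀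
  have h1m : Tendsto (fun m => 1 - Y m) atTop (𝓝 1) := by simpa using tendsto_const_nhds.sub hY
  have h1p : Tendsto (fun m => 1 + Y m) atTop (𝓝 1) := by simpa using tendsto_const_nhds.add hY
  have hdm : Tendsto (fun m => (1 - Y m).det) atTop (𝓝 1) := by
    have h := ((continuous_id.matrix_det).tendsto (1 : Matrix (Fin 3) (Fin 3) K)).comp h1m
    simpa [Function.comp_def] using h
  have hdp : Tendsto (fun m => (1 + Y m).det) atTop (𝓝 1) := by
    have h := ((continuous_id.matrix_det).tendsto (1 : Matrix (Fin 3) (Fin 3) K)).comp h1p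
    simpa [Function.comp_def] using h
  -- from some index on, `det(1 ∓ Y m) ≠ 0`
  obtain ⟨n₀, hn₀⟩ : ∃ n₀, ∀ m, n₀ ≤ m → (1 - Y m).det ≠ 0 ∧ (1 + Y m).det ≠ 0 :=
    eventually_atTop.mp ((hdm.eventually_ne one_ne_zero).and (hdp.eventually_ne one_ne_zero))
  have hm : ∀ n, IsUnit (1 - Y (n + n₀)).det := fun n => isUnit_iff_ne_zero.2 (hn₀ _ (Nat.le_add_left _ _)).1
  have hp : ∀ n, IsUnit (1 + Y (n + n₀)).det := fun n => isUnit_iff_ne_zero.2 (hn₀ _ (Nat.le_add_left _ _)).2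
  -- the scaled Lie elements are skew and commute with `g`
  have hσtm : ∀ m, σ (t ^ m) = t ^ m := fun m => by rw [map_pow, hσt]
  have hYskew : ∀ m, ((Y m).map σ)ᵀ * J + J * Y m = 0 := fun m => skew_smul_of_fixed σ hskew (hσtm m)
  have hYcomm : ∀ m, Y m * g = g * Y m := fun m => by
    simp only [hY_def, Matrix.smul_mul, Matrix.mul_smul, hcomm]
  -- the units `u n = c(Y (n + n₀))`
  let u : ℕ → ↥(unitaryGroupOfForm σ J) := fun n =>
    ⟨cayleyGL (Y (n + n₀)) (hm n) (hp n), mem_unitaryGroupOfForm_iff.2 (transpose_map_cayley_mul_mul_cayley σ (hm n) (hYskew _))⟩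
  have hu_coe : ∀ n, ((u n : GL (Fin 3) K) : Matrix (Fin 3) (Fin 3) K) = cayley (Y (n + n₀)) := fun n => rfl
  have hu_inv : ∀ n, (((u n : GL (Fin 3) K)⁻¹ : GL (Fin 3) K) : Matrix (Fin 3) (Fin 3) K) = cayley (-Y (n + n₀)) := fun n => rfl
  -- the limits of the two matrices
  have hshift : Tendsto (fun n => Y (n + n₀)) atTop (𝓝 0) := hY.comp (tendsto_add_atTop_nat n₀)
  have hcay : Tendsto (fun n => cayley (Y (n + n₀))) atTop (𝓝 1) := by
    have ha : Tendsto (fun n => 1 + Y (n + n₀)) atTop (𝓝 1) := by simpa using tendsto_const_nhds.add hshift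
    have hb : Tendsto (fun n => (1 - Y (n + n₀))⁻¹) atTop (𝓝 1) :=
      tendsto_inv_of_tendsto_one (by simpa using tendsto_const_nhds.sub hshift)
    simpa [cayley_def] using ha.mul hb
  have hcay' : Tendsto (fun n => cayley (-Y (n + n₀))) atTop (𝓝 1) := by
    have ha : Tendsto (fun n => 1 + -Y (n + n₀)) atTop (𝓝 1) := by simpa using tendsto_const_nhds.add hshift.neg
    have hb : Tendsto (fun n => (1 - -Y (n + n₀))⁻¹) atTop (𝓝 1) :=
      tendsto_inv_of_tendsto_one (by simpa using tendsto_const_nhds.sub hshift.neg)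
    simpa [cayley_def] using ha.mul hb
  refine ⟨X₀, n₀, u, hskew, hcomm, hXsep, fun n => ⟨hm n, hp n, hu_coe n, hu_inv n⟩, fun n => ?_, fun n => ?_, fun n => ?_,
    hdm.comp (tendsto_add_atTop_nat n₀), ?_⟩
  · -- `u n` commutes with `g`
    rw [hu_coe]
    exact cayley_comm_of_comm (hm n) (hYcomm _)
  · -- `χ_{u n}` is separable
    rw [hu_coe, separable_charpoly_cayley_iff h2u (hm n), hY_def, separable_charpoly_smul_iff ((isUnit_iff_ne_zero.2 ht0).pow _)]
    exact hXsep
  · -- the discriminant identity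
    rw [hu_coe, hY_def, discr_charpoly_cayley_smul _ (hm n), ← pow_mul, mul_comm (n + n₀) 6]
  · -- `u n → 1` in `U(σ, J)(K) ≤ GL₃(K)`: through `g ↦ (g, g⁻¹) ∈ M₃(K) × M₃(K)ᵐᵒᵖ`
    rw [tendsto_subtype_rng, Units.isEmbedding_embedProduct.isInducing.tendsto_nhds_iff]
    have h1 : Units.embedProduct (Matrix (Fin 3) (Fin 3) K) ((1 : ↥(unitaryGroupOfForm σ J)) : GL (Fin 3) K) =
        ((1 : Matrix (Fin 3) (Fin 3) K), MulOpposite.op (1 : Matrix (Fin 3) (Fin 3) K)) := by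
      simp
    rw [h1]
    have hpair : Tendsto (fun n => (cayley (Y (n + n₀)), MulOpposite.op (cayley (-Y (n + n₀))))) atTop
        (𝓝 ((1 : Matrix (Fin 3) (Fin 3) K), MulOpposite.op (1 : Matrix (Fin 3) (Fin 3) K))) :=
      hcay.prodMk_nhds ((MulOpposite.continuous_op.tendsto 1).comp hcay')
    refine hpair.congr' (Eventually.of_forall fun n => ?_)
    rfl

end Normed

/-! ## §4 The CM export: the ray in the Cartan subgroup `Z(γ₀)` of `Gqs L v = U(Φ₃)(L⁺_v)` at a non-split place -/

section CM

variable (L : Type) [Field L] [NumberField L] [IsCMField L] {v : HeightOneSpectrum (𝓞 ↥(maximalRealSubfield L))}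
  (w : PlacesOver L v) (hw : IsCMField.complexConj L • w.1 = w.1)

/-- **The norm-one set `{z ∈ L_w | σ_w z · z = 1}` is INFINITE** at a place `w` fixed by complex conjugation: with `δ ≠ 0`, `σ_w δ = −δ` (★ `exists_antifixed`), the
elements `z_a = (a + δ)(a − δ)⁻¹`, `a ∈ ℕ`, are norm-one (`σ_w z_a = (a − δ)(a + δ)⁻¹ = z_a⁻¹`) and pairwise distinct (`z_a = z_b ⟹ 2δ(b − a) = 0`).
[cite: CasselsFrohlichANT1967, Ch. VII §1.1] -/
theorem normOne_infinite :
    {z : w.1.adicCompletion L | galAdicCompletionMap (L := L) (IsCMField.complexConj L) hw z * z = 1}.Infinite := by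
  haveI : CharZero (w.1.adicCompletion L) := charZero_of_injective_algebraMap (algebraMap L (w.1.adicCompletion L)).injective
  obtain ⟨δ, hδ0, hσδ⟩ := exists_antifixed L w hw
  set σ := galAdicCompletionMap (L := L) (IsCMField.complexConj L) hw with hσ_def
  -- `a ± δ ≠ 0` for `a ∈ ℕ`: otherwise `δ = ∓a` is `σ`-fixed, so `δ = −δ`, `δ = 0`
  have hfix : ∀ a : ℕ, σ (a : w.1.adicCompletion L) = a := fun a => map_natCast σ a
  have hne : ∀ a : ℕ, (a : w.1.adicCompletion L) - δ ≠ 0 ∧ (a : w.1.adicCompletion L) + δ ≠ 0 := by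
    intro a
    constructor
    · intro h
      have hδ : δ = a := by linear_combination -h
      have h2 : σ δ = δ := by rw [hδ, hfix]
      rw [hσδ] at h2
      exact hδ0 (by linear_combination h2 / (-2 : w.1.adicCompletion L) * 1)
    · intro h
      have hδ : δ = -(a : w.1.adicCompletion L) := by linear_combination h
      have h2 : σ δ = δ := by rw [hδ, map_neg, hfix]
      rw [hσδ] at h2
      exact hδ0 (by linear_combination h2 / (-2 : w.1.adicCompletion L) * 1)
  refine Set.infinite_of_injective_forall_mem
    (f := fun a : ℕ => ((a : w.1.adicCompletion L) + δ) * ((a : w.1.adicCompletion L) - δ)⁻¹) ?_ ?_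
  · intro a b hab
    have ha := (hne a).1
    have hb := (hne b).1
    have h : ((a : w.1.adicCompletion L) + δ) * ((b : w.1.adicCompletion L) - δ) =
        ((b : w.1.adicCompletion L) + δ) * ((a : w.1.adicCompletion L) - δ) := by
      have := hab
      field_simp at this
      linear_combination this
    have h' : (2 * δ) * ((b : w.1.adicCompletion L) - a) = 0 := by linear_combination h
    rcases mul_eq_zero.mp h' with h2δ | hba
    · exact absurd (by simpa using h2δ) hδ0
    · exact_mod_cast (sub_eq_zero.mp hba).symm
  · intro a
    obtain ⟨ha, ha'⟩ := hne a
    simp only [Set.mem_setOf_eq, map_mul, map_add, map_sub, map_inv₀, hfix, hσδ]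
    have ha'' : (a : w.1.adicCompletion L) - -δ ≠ 0 := by rwa [sub_neg_eq_add]
    field_simp
    ring

/-- **THE RAY, WITH ITS CAYLEY PRESENTATION READ AT THE PLACE `w ∣ v`** (`v` non-split, `e` = ★ `localNonsplitEquiv` the one-place model
`U(Φ₃)(L⁺_v) ≃ₜ* U(σ_w, Φ₃)(L_w)`).  For every REGULAR `γ₀ ∈ U(Φ₃)(L⁺_v)` there are `t ∈ L_w` (`σ_w t = t ≠ 0`, `v_w(t) < 1`), a SKEW `X₀ ∈ M₃(L_w)` commuting
with `e γ₀` with `χ_{X₀}` separable, an index `n₀`, and a sequence `γseq : ℕ → U(Φ₃)(L⁺_v)` such that: every `γseq n` COMMUTES with `γ₀` (lies in the Cartan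
subgroup `Z(γ₀)`) and is REGULAR; `γseq n → 1`; `e (γseq n) = c(t^{n+n₀}•X₀)` with `det(1 − t^{n+n₀}X₀)` a unit tending to `1`; and
**`disc(χ_{e(γseq n)})·det(1 − t^{n+n₀}X₀)⁴ = 2⁶·t^{6(n+n₀)}·disc(χ_{X₀})`** — the Weyl discriminant decays along the ray at the exact rate `|t|_w^{6n}`.
[cite: Rogawski1990, §3.1 p. 19; §8.1 (8.1.1) p. 116] [cite: PlatonovRapinchuk1994, §3.3] -/
theorem compactCartanRegularRay_controlled (γ₀ : ↥(«local» L (IsCMField.complexConj L) 3 (qsForm L) v))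
    (hγ₀ : IsRegularElt (γ₀ : GL (Fin 3) (LocalRing L v))) :
    ∃ (t : w.1.adicCompletion L) (X₀ : Matrix (Fin 3) (Fin 3) (w.1.adicCompletion L)) (n₀ : ℕ)
      (γseq : ℕ → ↥(«local» L (IsCMField.complexConj L) 3 (qsForm L) v)),
      galAdicCompletionMap (L := L) (IsCMField.complexConj L) hw t = t ∧ t ≠ 0 ∧ Valued.v t < 1 ∧
      (X₀.map (galAdicCompletionMap (L := L) (IsCMField.complexConj L) hw))ᵀ * placeForm (qsForm L) w.1 +
          placeForm (qsForm L) w.1 * X₀ = 0 ∧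
      X₀ * (((localNonsplitEquiv (IsCMField.complexConj L) (qsForm L) (IsCMField.complexConj_ne_one L) w hw γ₀ : ↥(unitaryGroupOfForm (galAdicCompletionMap (L := L) (IsCMField.complexConj L) hw) (placeForm (qsForm L) w.1))) :
            GL (Fin 3) (w.1.adicCompletion L)) : Matrix (Fin 3) (Fin 3) (w.1.adicCompletion L)) =
        (((localNonsplitEquiv (IsCMField.complexConj L) (qsForm L) (IsCMField.complexConj_ne_one L) w hw γ₀ : ↥(unitaryGroupOfForm (galAdicCompletionMap (L := L) (IsCMField.complexConj L) hw) (placeForm (qsForm L) w.1))) :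
            GL (Fin 3) (w.1.adicCompletion L)) : Matrix (Fin 3) (Fin 3) (w.1.adicCompletion L)) * X₀ ∧
      X₀.charpoly.Separable ∧
      (∀ n, γseq n * γ₀ = γ₀ * γseq n ∧ IsRegularElt (γseq n : GL (Fin 3) (LocalRing L v))) ∧
      Tendsto γseq atTop (𝓝 1) ∧
      (∀ n, IsUnit (1 - t ^ (n + n₀) • X₀).det ∧
        (((localNonsplitEquiv (IsCMField.complexConj L) (qsForm L) (IsCMField.complexConj_ne_one L) w hw (γseq n) : ↥(unitaryGroupOfForm (galAdicCompletionMap (L := L) (IsCMField.complexConj L) hw) (placeForm (qsForm L) w.1))) :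
            GL (Fin 3) (w.1.adicCompletion L)) : Matrix (Fin 3) (Fin 3) (w.1.adicCompletion L)) = cayley (t ^ (n + n₀) • X₀) ∧
        (((localNonsplitEquiv (IsCMField.complexConj L) (qsForm L) (IsCMField.complexConj_ne_one L) w hw (γseq n) : ↥(unitaryGroupOfForm (galAdicCompletionMap (L := L) (IsCMField.complexConj L) hw) (placeForm (qsForm L) w.1))) :
            GL (Fin 3) (w.1.adicCompletion L)) : Matrix (Fin 3) (Fin 3) (w.1.adicCompletion L)).charpoly.discr * (1 - t ^ (n + n₀) • X₀).det ^ 4 =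
          2 ^ 6 * t ^ (6 * (n + n₀)) * X₀.charpoly.discr) ∧
      Tendsto (fun n => (1 - t ^ (n + n₀) • X₀).det) atTop (𝓝 1) := by
  -- the data at `w`: `σ_w`, the model `e`, the parameter `t = ϖ σ_w ϖ`
  set σ := galAdicCompletionMap (L := L) (IsCMField.complexConj L) hw with hσ_def
  set e := localNonsplitEquiv (IsCMField.complexConj L) (qsForm L) (IsCMField.complexConj_ne_one L) w hw with he_def
  obtain ⟨t, ht0, hσt, ht1, -⟩ := exists_fixed_not_cube L w hw
  have ht1' : ‖t‖ < 1 := Valued.toNormedField.norm_lt_one_iff.mpr ht1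
  -- the regular unitary `g = e γ₀` in the model
  set g : Matrix (Fin 3) (Fin 3) (w.1.adicCompletion L) :=
    (((e γ₀ : ↥(unitaryGroupOfForm σ (placeForm (qsForm L) w.1))) : GL (Fin 3) (w.1.adicCompletion L)) : Matrix (Fin 3) (Fin 3) (w.1.adicCompletion L)) with hg_def
  have hU : (g.map σ)ᵀ * placeForm (qsForm L) w.1 * g = placeForm (qsForm L) w.1 := mem_unitaryGroupOfForm_iff.1 (e γ₀).2
  have hJ : IsUnit (placeForm (qsForm L) w.1).det := by
    rw [placeForm_qsForm_eq L w, Matrix.det_fin_three]; simp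
  have hreg : g.charpoly.Separable := (isRegularElt_iff_separable_localNonsplitEquiv L w hw γ₀).mp hγ₀
  obtain ⟨X₀, n₀, u, hskew, hcomm, hXsep, hunits, hug, husep, hdisc, hdet, hu1⟩ :=
    exists_cayleyRay σ two_ne_zero hJ hU hreg (normOne_infinite L w hw) hσt ht0 ht1'
  -- pull the ray back along the homeomorphic isomorphism `e`
  refine ⟨t, X₀, n₀, fun n => e.symm (u n), hσt, ht0, ht1, hskew, hcomm, hXsep, fun n => ⟨?_, ?_⟩, ?_, fun n => ⟨(hunits n).1, ?_, ?_⟩, hdet⟩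
  · -- commutes with `γ₀`: read in the model, where `u n` commutes with `g = e γ₀`
    apply e.injective
    rw [map_mul, map_mul, ContinuousMulEquiv.apply_symm_apply]
    exact Subtype.ext (Units.ext (hug n))
  · -- regular: read at `w`
    rw [isRegularElt_iff_separable_localNonsplitEquiv L w hw, ← he_def, ContinuousMulEquiv.apply_symm_apply]
    exact husep n
  · -- tends to `1`
    have hc : Continuous (fun x => e.symm x) := e.symm.continuous
    have ht : Tendsto (fun x => e.symm x) (𝓝 1) (𝓝 (1 : ↥(«local» L (IsCMField.complexConj L) 3 (qsForm L) v))) := by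
      simpa only [map_one] using hc.tendsto 1
    exact ht.comp hu1
  · rw [ContinuousMulEquiv.apply_symm_apply]
    exact (hunits n).2.2.1
  · rw [ContinuousMulEquiv.apply_symm_apply]
    exact hdisc n

/-- **THE RAY OF REGULAR ELEMENTS IN A CARTAN SUBGROUP `T = Z(γ₀)` OF `Gqs L v = U(Φ₃)(L⁺_v)` AT A NON-SPLIT PLACE** — the consumer form (binders `γseq ∕ hγT ∕ hγ1`
of ★ `K2E3GermResidueAtCubicTorusOfHomogeneity.germResidueAtTorus_of_homogeneityRay_nonsplit` for EVERY Cartan subgroup `Z(γ₀)`, `γ₀` regular; compactness of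
`T` is not needed): there is a sequence of REGULAR elements of `T` tending to `1` — the Cayley ray `c(t^{n+n₀}•X₀)` of `compactCartanRegularRay_controlled` through a
regular element `X₀` of the Lie algebra of `T`, along which the Weyl discriminant decays at the exact rate `|t|_w^{6n}`.
[cite: Rogawski1990, §3.1 p. 19; §3.6 p. 31; §8.1 (8.1.1) p. 116; §12.7 p. 194] [cite: PlatonovRapinchuk1994, §3.3] -/
theorem compactCartanRegularRay (v : HeightOneSpectrum (𝓞 ↥(maximalRealSubfield L)))
    (hns : ∀ w : PlacesOver L v, IsCMField.complexConj L • w.1 = w.1)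
    (T : Subgroup (Gqs L v)) (γ₀ : Gqs L v) (hγ₀ : IsRegularElt (γ₀.val : GL (Fin 3) (UnitaryGroup.LocalRing L v)))
    (hT : T = Subgroup.centralizer ({γ₀} : Set (Gqs L v))) :
    ∃ γseq : ℕ → Gqs L v,
      (∀ n, γseq n ∈ (T : Set (Gqs L v)) ∧ IsRegularElt ((γseq n).val : GL (Fin 3) (UnitaryGroup.LocalRing L v))) ∧
      Tendsto γseq atTop (𝓝 (1 : Gqs L v)) := by
  obtain ⟨w⟩ := (inferInstance : Nonempty (PlacesOver L v))
  obtain ⟨-, -, -, γseq, -, -, -, -, -, -, hγ, hγ1, -, -⟩ := compactCartanRegularRay_controlled L w (hns w) γ₀ hγ₀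
  refine ⟨γseq, fun n => ⟨?_, (hγ n).2⟩, hγ1⟩
  rw [hT]
  exact Subgroup.mem_centralizer_singleton_iff.2 (hγ n).1

end CM

end Summit.HodgeConjecture.HodgeConjecture.Cruxes.H413.K2E3CompactCartanRegularRay

end
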